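import Mathlib
import Literature.NumberTheory.Transcendental.LindemannWeierstrassProofs

/-!
# Kernel translates of a pair at rank 2: moving sector and transcendental period

For `x = (x₀, x₁) ∈ ℂ²` and `k ∈ ℤ²` put `x_k := x + 2πik` (so `e^{x_k} = eˣ`). A translate is a
MATE of `x` if it is ℚ-linearly independent and `(x_k, eˣ)` satisfies every rational polynomial
relation of `(x, eˣ)`.

* `movingSector_finite` — if `trdeg ℚ(x, eˣ) < 2` and some `e^{x_i}` is transcendental, `x` has
  finitely many mate translates (each coordinate is a root of a nonzero `p_j(·, e^{x_i})`).
* `not_isAlgebraic_intCombination` — HERMITE–LINDEMANN ENDGAME: for independent `x` with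
  algebraic exponentials no nonzero integer combination `q·x` is algebraic.
* `isAlgebraic_of_vanish_on_line`, `logSector_transcendentalPeriod` — if `e^{x₀}, e^{x₁}` are
  algebraic, `F ∈ ℚ[z₀, z₁]` is nonzero and `2πi` is transcendental over `ℚ[x₀, x₁]`, then no
  nonzero translate lies on `V(F)` (`t ↦ F(x + tk)` vanishes identically, so `F` vanishes on
  the rational-direction line `x + ℂk`, forcing `k₁x₀ − k₀x₁` algebraic).

## References

* [Lindemann1882] F. Lindemann, *Über die Zahl π*, Math. Ann. 20 (1882) — `e^α` is
  transcendental for algebraic `α ≠ 0` (tree: `transcendental_exp_holds`).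
* [Lang1966] S. Lang, *Introduction to transcendental numbers*, Addison–Wesley 1966, Ch. II §1.
-/

noncomputable section

open Complex Set

namespace Literature.NumberTheory.Transcendental.KernelTranslatesRankTwo

/-! ## Bivariate rational polynomials specialised at a transcendental number -/

/-- Evaluating `p ∈ ℚ[X₀, X₁]` at `(z, y)` through `finSuccEquiv`: specialise the coefficients
(polynomials in `X₁`) at `y`, then evaluate the resulting polynomial in `X₀` at `z`. [folklore] -/
theorem eval_map_finSuccEquiv (p : MvPolynomial (Fin 2) ℚ) (z y : ℂ) :
    ((MvPolynomial.finSuccEquiv ℚ 1 p).map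
        (MvPolynomial.aeval (fun _ : Fin 1 => y) : MvPolynomial (Fin 1) ℚ →ₐ[ℚ] ℂ).toRingHom).eval
      z = MvPolynomial.aeval ![z, y] p := by
  -- adapted from Literature/NumberTheory/Transcendental/PlaneCurveTranscendence.lean
  set s : MvPolynomial (Fin 1) ℚ →ₐ[ℚ] ℂ := MvPolynomial.aeval (fun _ : Fin 1 => y) with hs
  let f : MvPolynomial (Fin 2) ℚ →+* ℂ :=
    (Polynomial.evalRingHom z).comp ((Polynomial.mapRingHom s.toRingHom).comp
      (MvPolynomial.finSuccEquiv ℚ 1).toRingEquiv.toRingHom)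
  have hfg : f = (MvPolynomial.aeval ![z, y] : MvPolynomial (Fin 2) ℚ →ₐ[ℚ] ℂ).toRingHom := by
    refine MvPolynomial.ringHom_ext (fun r => ?_) (fun i => ?_)
    · have hC : (MvPolynomial.finSuccEquiv ℚ 1) (MvPolynomial.C r) = Polynomial.C (MvPolynomial.C r) := by
        simp [MvPolynomial.finSuccEquiv_apply]
      simp [f, hC, hs]
    · fin_cases i
      · simp [f, MvPolynomial.finSuccEquiv_X_zero]
      · have h1 : (MvPolynomial.X ⟨1, by norm_num⟩ : MvPolynomial (Fin 2) ℚ) =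
            MvPolynomial.X (0 : Fin 1).succ := rfl
        have h2 : (MvPolynomial.finSuccEquiv ℚ 1).toRingEquiv.toRingHom
            (MvPolynomial.X (0 : Fin 1).succ) = Polynomial.C (MvPolynomial.X 0) :=
          MvPolynomial.finSuccEquiv_X_succ
        simp only [f, RingHom.coe_comp, Function.comp_apply, h1, h2, Polynomial.coe_mapRingHom,
          Polynomial.map_C, Polynomial.coe_evalRingHom, Polynomial.eval_C]
        simp [hs]
  exact RingHom.congr_fun hfg p

/-- For `y` transcendental and `p ≠ 0`, the specialised polynomial `p(·, y)` is nonzero.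
[folklore] -/
theorem map_finSuccEquiv_ne_zero {p : MvPolynomial (Fin 2) ℚ} (hp : p ≠ 0) {y : ℂ}
    (hy : Transcendental ℚ y) :
    (MvPolynomial.finSuccEquiv ℚ 1 p).map
        (MvPolynomial.aeval (fun _ : Fin 1 => y) : MvPolynomial (Fin 1) ℚ →ₐ[ℚ] ℂ).toRingHom ≠ 0 := by
  have hinj : Function.Injective
      (MvPolynomial.aeval (fun _ : Fin 1 => y) : MvPolynomial (Fin 1) ℚ →ₐ[ℚ] ℂ) :=
    algebraicIndependent_unique_type_iff.mpr hy
  intro h0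
  apply hp
  have h1 : MvPolynomial.finSuccEquiv ℚ 1 p = 0 := by
    apply (Polynomial.map_injective _ hinj)
    rw [h0, Polynomial.map_zero]
  simpa using h1

/-- The zeros `z` of `p(z, y) = 0`, `p ≠ 0`, `y` transcendental, form a finite set. [folklore] -/
theorem finite_setOf_aeval_eq_zero {p : MvPolynomial (Fin 2) ℚ} (hp : p ≠ 0) {y : ℂ}
    (hy : Transcendental ℚ y) : {z : ℂ | MvPolynomial.aeval ![z, y] p = 0}.Finite := by
  set f := (MvPolynomial.finSuccEquiv ℚ 1 p).map
        (MvPolynomial.aeval (fun _ : Fin 1 => y) : MvPolynomial (Fin 1) ℚ →ₐ[ℚ] ℂ).toRingHom with hf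
  have hf0 : f ≠ 0 := map_finSuccEquiv_ne_zero hp hy
  refine (f.rootSet_finite ℂ).subset ?_
  intro z hz
  rw [Polynomial.mem_rootSet_of_ne hf0, Polynomial.coe_aeval_eq_eval, hf, eval_map_finSuccEquiv]
  exact hz

/-- `trdeg ℚ K < 2` makes every pair of elements of `K` algebraically dependent over `ℚ`.
[folklore] -/
theorem exists_mvPolynomial_of_trdeg_lt_two {K : IntermediateField ℚ ℂ}
    (hK : Algebra.trdeg ℚ K < (2 : Cardinal)) {a b : ℂ} (ha : a ∈ K) (hb : b ∈ K) :
    ∃ p : MvPolynomial (Fin 2) ℚ, p ≠ 0 ∧ MvPolynomial.aeval ![a, b] p = 0 := by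
  by_contra h
  push Not at h
  have hind : AlgebraicIndependent ℚ (![⟨a, ha⟩, ⟨b, hb⟩] : Fin 2 → K) := by
    rw [algebraicIndependent_iff]
    intro p hp
    by_contra hp0
    apply h p hp0
    have e : (![a, b] : Fin 2 → ℂ) = algebraMap K ℂ ∘ (![⟨a, ha⟩, ⟨b, hb⟩] : Fin 2 → K) := by
      ext i; fin_cases i <;> rfl
    rw [e, MvPolynomial.aeval_algebraMap_apply, hp, map_zero]
  have h2 := hind.cardinalMk_le_trdeg
  simp at h2
  exact absurd hK (not_lt.2 h2)

/-- A nonzero polynomial vanishing at a point has an irreducible factor vanishing there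
(`ℚ[z₀, z₁]` is factorial). [folklore] -/
theorem exists_irreducible_of_aeval_eq_zero {F₀ : MvPolynomial (Fin 2) ℚ} (hF₀ : F₀ ≠ 0)
    {x : Fin 2 → ℂ} (hx : MvPolynomial.aeval x F₀ = 0) :
    ∃ F : MvPolynomial (Fin 2) ℚ, Irreducible F ∧ MvPolynomial.aeval x F = 0 := by
  revert hF₀ hx
  induction F₀ using UniqueFactorizationMonoid.induction_on_prime with
  | h₁ => intro h; exact absurd rfl h
  | h₂ u hu =>
    intro _ hx
    exact absurd hx (hu.map (MvPolynomial.aeval x)).ne_zero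
  | h₃ a p ha hp ih =>
    intro _ hx
    rw [map_mul] at hx
    rcases mul_eq_zero.mp hx with h | h
    · exact ⟨p, hp.irreducible, h⟩
    · exact ih ha h

/-! ## Kernel translates -/

/-- Kernel translates have the same exponentials. [folklore] -/
theorem cexp_translate (x : Fin 2 → ℂ) (k : Fin 2 → ℤ) (i : Fin 2) :
    cexp (x i + 2 * ↑Real.pi * I * (k i : ℂ)) = cexp (x i) := by
  rw [Complex.exp_add, mul_comm (2 * ↑Real.pi * I) ((k i : ℂ)), Complex.exp_int_mul_two_pi_mul_I,
    mul_one]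

/-- Kernel translates have the same exponentials (function form). [folklore] -/
theorem cexp_comp_translate (x : Fin 2 → ℂ) (k : Fin 2 → ℤ) :
    (cexp ∘ fun i => x i + 2 * ↑Real.pi * I * (k i : ℂ)) = cexp ∘ x := by
  funext i
  exact cexp_translate x k i

/-- A relation between `x j` and `e^{x i}` transfers to a mate translate. [folklore] -/
theorem transfer_pair {x : Fin 2 → ℂ} {k : Fin 2 → ℤ}
    (hk : ∀ p : MvPolynomial (Fin 2 ⊕ Fin 2) ℚ, MvPolynomial.aeval (Sum.elim x (cexp ∘ x)) p = 0 →
      MvPolynomial.aeval (Sum.elim (fun i => x i + 2 * ↑Real.pi * I * (k i : ℂ))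
        (cexp ∘ fun i => x i + 2 * ↑Real.pi * I * (k i : ℂ))) p = 0)
    (j i : Fin 2) {p : MvPolynomial (Fin 2) ℚ} (hp : MvPolynomial.aeval ![x j, cexp (x i)] p = 0) :
    MvPolynomial.aeval ![x j + 2 * ↑Real.pi * I * (k j : ℂ), cexp (x i)] p = 0 := by
  have h := hk (MvPolynomial.rename ![Sum.inl j, Sum.inr i] p)
  rw [MvPolynomial.aeval_rename, MvPolynomial.aeval_rename, cexp_comp_translate] at h
  have e1 : (Sum.elim x (cexp ∘ x)) ∘ ![Sum.inl j, Sum.inr i] = ![x j, cexp (x i)] := by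
    ext m; fin_cases m <;> rfl
  have e2 : (Sum.elim (fun i => x i + 2 * ↑Real.pi * I * (k i : ℂ)) (cexp ∘ x)) ∘
      ![Sum.inl j, Sum.inr i] = ![x j + 2 * ↑Real.pi * I * (k j : ℂ), cexp (x i)] := by
    ext m; fin_cases m <;> rfl
  rw [e1, e2] at h
  exact h hp

/-- A relation among the `x j` alone transfers to a mate translate. [folklore] -/
theorem transfer_inl {x : Fin 2 → ℂ} {k : Fin 2 → ℤ}
    (hk : ∀ p : MvPolynomial (Fin 2 ⊕ Fin 2) ℚ, MvPolynomial.aeval (Sum.elim x (cexp ∘ x)) p = 0 →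
      MvPolynomial.aeval (Sum.elim (fun i => x i + 2 * ↑Real.pi * I * (k i : ℂ))
        (cexp ∘ fun i => x i + 2 * ↑Real.pi * I * (k i : ℂ))) p = 0)
    {p : MvPolynomial (Fin 2) ℚ} (hp : MvPolynomial.aeval x p = 0) :
    MvPolynomial.aeval (fun i => x i + 2 * ↑Real.pi * I * (k i : ℂ)) p = 0 := by
  have h := hk (MvPolynomial.rename Sum.inl p)
  rw [MvPolynomial.aeval_rename, MvPolynomial.aeval_rename, Sum.elim_comp_inl,
    Sum.elim_comp_inl] at h
  exact h hp

/-- The translation `k ↦ x + 2πi k` is injective on integer vectors. [folklore] -/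
theorem translate_injective (x : Fin 2 → ℂ) :
    Function.Injective (fun k : Fin 2 → ℤ => fun i => x i + 2 * ↑Real.pi * I * (k i : ℂ)) := by
  intro k k' h
  funext i
  have hi := congr_fun h i
  have h2 : (2 * ↑Real.pi * I : ℂ) ≠ 0 := by
    simp [Real.pi_ne_zero, Complex.I_ne_zero]
  have : ((k i : ℂ)) = (k' i : ℂ) := by
    have := add_left_cancel hi
    exact mul_left_cancel₀ h2 this
  exact_mod_cast this

/-! ## The moving sector: some `e^{x_i}` transcendental -/

/-- MOVING SECTOR. If `trdeg ℚ(x, eˣ) < 2` and some `e^{x_i}` is transcendental, only finitely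
many kernel translates of `x` are mates of `x`: each coordinate `x_j + 2πik_j` of a mate is a
root of the nonzero polynomial `p_j(·, e^{x_i})`. [cite: Lang1966, Ch. II §1] -/
theorem movingSector_finite (x : Fin 2 → ℂ)
    (htr : Algebra.trdeg ℚ ↥(IntermediateField.adjoin ℚ (Set.range x ∪ Set.range (cexp ∘ x))) <
      (2 : Cardinal))
    (i : Fin 2) (hy : Transcendental ℚ (cexp (x i))) :
    {k : Fin 2 → ℤ | LinearIndependent ℚ (fun i => x i + 2 * ↑Real.pi * I * (k i : ℂ)) ∧
      ∀ p : MvPolynomial (Fin 2 ⊕ Fin 2) ℚ, MvPolynomial.aeval (Sum.elim x (cexp ∘ x)) p = 0 →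
        MvPolynomial.aeval (Sum.elim (fun i => x i + 2 * ↑Real.pi * I * (k i : ℂ))
          (cexp ∘ fun i => x i + 2 * ↑Real.pi * I * (k i : ℂ))) p = 0}.Finite := by
  set K := IntermediateField.adjoin ℚ (Set.range x ∪ Set.range (cexp ∘ x)) with hK
  have hxK : ∀ j, x j ∈ K := fun j =>
    IntermediateField.subset_adjoin ℚ _ (Or.inl (Set.mem_range_self j))
  have hyK : cexp (x i) ∈ K :=
    IntermediateField.subset_adjoin ℚ _ (Or.inr ⟨i, rfl⟩)
  choose p hp0 hp using fun j => exists_mvPolynomial_of_trdeg_lt_two htr (hxK j) hyK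
  set S : Fin 2 → Set ℂ := fun j => {z : ℂ | MvPolynomial.aeval ![z, cexp (x i)] (p j) = 0} with hS
  have hSfin : ∀ j, (S j).Finite := fun j => finite_setOf_aeval_eq_zero (hp0 j) hy
  have hpi : (Set.pi Set.univ S).Finite := Set.Finite.pi fun j => hSfin j
  refine ((hpi.preimage (translate_injective x).injOn)).subset ?_
  rintro k ⟨-, hk⟩
  simp only [Set.mem_preimage, Set.mem_pi, Set.mem_univ, true_implies]
  intro j
  exact transfer_pair hk j i (hp j)

/-! ## The log sector: `e^{x₀}, e^{x₁}` algebraic -/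

/-- If a nonzero `F ∈ ℚ[z₀, z₁]` vanishes on the whole line `x + ℂ·w` with integer direction
`w ≠ 0`, then the rational linear form `w₁ x₀ − w₀ x₁` (constant on that line) is algebraic:
in the rational coordinates `u = w₁z₀ − w₀z₁`, `v = (w·z)/|w|²` the polynomial becomes
`F̃(u, v) = Σ c_j(u) vʲ` with `F̃(u(x), ·) ≡ 0`, so every `c_j(u(x)) = 0`, and some `c_j ≠ 0`.
[folklore] -/
theorem isAlgebraic_of_vanish_on_line (x : Fin 2 → ℂ) (w : Fin 2 → ℤ) (hw : w ≠ 0)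
    (F : MvPolynomial (Fin 2) ℚ) (hF : F ≠ 0)
    (hvan : ∀ t : ℂ, MvPolynomial.aeval (fun j => x j + t * (w j : ℂ)) F = 0) :
    IsAlgebraic ℚ ((w 1 : ℂ) * x 0 - (w 0 : ℂ) * x 1) := by
  -- the integer `N = w₀² + w₁²` is nonzero
  have hNz : (w 0) ^ 2 + (w 1) ^ 2 ≠ 0 := by
    intro h
    apply hw
    have h0 : w 0 = 0 := by nlinarith [sq_nonneg (w 0), sq_nonneg (w 1)]
    have h1 : w 1 = 0 := by nlinarith [sq_nonneg (w 0), sq_nonneg (w 1)]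
    funext i; fin_cases i <;> simp [h0, h1]
  set N : ℚ := (((w 0) ^ 2 + (w 1) ^ 2 : ℤ) : ℚ) with hN
  have hN0 : N ≠ 0 := by rw [hN]; exact_mod_cast hNz
  have hNC : (N : ℂ) ≠ 0 := by exact_mod_cast hN0
  have hNC' : (N : ℂ) = (w 0 : ℂ) ^ 2 + (w 1 : ℂ) ^ 2 := by rw [hN]; push_cast; ring
  -- the substituted polynomial `G(V, U) = F((U/N)·q + V·w)`, `q = (w₁, -w₀)`
  set σ : Fin 2 → MvPolynomial (Fin 2) ℚ :=
    ![MvPolynomial.C ((w 1 : ℚ) / N) * MvPolynomial.X 1 + MvPolynomial.C (w 0 : ℚ) * MvPolynomial.X 0,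
      MvPolynomial.C (-(w 0 : ℚ) / N) * MvPolynomial.X 1 + MvPolynomial.C (w 1 : ℚ) * MvPolynomial.X 0]
    with hσ
  set G : MvPolynomial (Fin 2) ℚ := MvPolynomial.aeval σ F with hG
  set κ : ℂ := (w 1 : ℂ) * x 0 - (w 0 : ℂ) * x 1 with hκ
  -- evaluation of `G`
  have hGeval : ∀ v u : ℂ, MvPolynomial.aeval ![v, u] G =
      MvPolynomial.aeval ![u * (w 1 : ℂ) / N + v * (w 0 : ℂ), -(u * (w 0 : ℂ)) / N + v * (w 1 : ℂ)]
        F := by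
    intro v u
    rw [hG, MvPolynomial.comp_aeval_apply]
    congr 1
    ext j
    fin_cases j
    · simp [hσ]; ring
    · simp [hσ]; ring
  -- `G(v, κ) = 0` for every `v`: the point `(κ/N) q + v w` lies on the line `x + ℂ w`
  have hGκ : ∀ v : ℂ, MvPolynomial.aeval ![v, κ] G = 0 := by
    intro v
    rw [hGeval]
    have e : (![κ * (w 1 : ℂ) / N + v * (w 0 : ℂ), -(κ * (w 0 : ℂ)) / N + v * (w 1 : ℂ)] : Fin 2 → ℂ) =
        fun j => x j + (v - ((w 0 : ℂ) * x 0 + (w 1 : ℂ) * x 1) / N) * (w j : ℂ) := by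
      funext j
      fin_cases j
      · simp [hκ]
        field_simp
        rw [hNC']
        ring
      · simp [hκ]
        field_simp
        rw [hNC']
        ring
    rw [e]
    exact hvan _
  -- `G ≠ 0`: the substitution is invertible, and `F ≠ 0` does not vanish on all of `ℂ²`
  have hG0 : G ≠ 0 := by
    intro hG0
    apply hF
    have hFC : ∀ z : Fin 2 → ℂ, MvPolynomial.aeval z F = 0 := by
      intro z
      have h := hGeval (((w 0 : ℂ) * z 0 + (w 1 : ℂ) * z 1) / N) ((w 1 : ℂ) * z 0 - (w 0 : ℂ) * z 1)
      rw [hG0, map_zero] at h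
      have e : (![((w 1 : ℂ) * z 0 - (w 0 : ℂ) * z 1) * (w 1 : ℂ) / N +
            ((w 0 : ℂ) * z 0 + (w 1 : ℂ) * z 1) / N * (w 0 : ℂ),
          -(((w 1 : ℂ) * z 0 - (w 0 : ℂ) * z 1) * (w 0 : ℂ)) / N +
            ((w 0 : ℂ) * z 0 + (w 1 : ℂ) * z 1) / N * (w 1 : ℂ)] : Fin 2 → ℂ) = z := by
        funext j
        fin_cases j
        · simp
          field_simp
          rw [hNC']
          ring
        · simp
          field_simp
          rw [hNC']
          ring
      rw [e] at h
      exact h.symm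
    apply MvPolynomial.map_injective (algebraMap ℚ ℂ) (algebraMap ℚ ℂ).injective
    rw [map_zero]
    apply MvPolynomial.funext
    intro z
    rw [MvPolynomial.eval_map, ← MvPolynomial.aeval_def, map_zero]
    exact hFC z
  -- if `κ` were transcendental, `G(·, κ)` would be a nonzero polynomial vanishing on `ℂ`
  by_contra htrans
  apply map_finSuccEquiv_ne_zero hG0 htrans
  apply Polynomial.funext
  intro v
  rw [eval_map_finSuccEquiv, Polynomial.eval_zero]
  exact hGκ v

/-- Integer powers of algebraic numbers are algebraic. [folklore] -/
theorem isAlgebraic_zpow {a : ℂ} (ha : IsAlgebraic ℚ a) (n : ℤ) : IsAlgebraic ℚ (a ^ n) := by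
  cases n with
  | ofNat m => simpa using ha.pow m
  | negSucc m => rw [zpow_negSucc]; exact (ha.pow (m + 1)).inv

/-- HERMITE–LINDEMANN ENDGAME: for a ℚ-linearly independent pair `x` with algebraic
exponentials, no nonzero integer combination `q₀ x₀ + q₁ x₁` is algebraic
(`e^{q·x} = (e^{x₀})^{q₀} (e^{x₁})^{q₁}` is algebraic, so `q·x = 0` by Hermite–Lindemann).
[cite: Lindemann1882] -/
theorem not_isAlgebraic_intCombination {x : Fin 2 → ℂ} (hx : LinearIndependent ℚ x)
    (halg : ∀ i, IsAlgebraic ℚ (cexp (x i))) (q : Fin 2 → ℤ) (hq : q ≠ 0)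
    (hκ : IsAlgebraic ℚ ((q 0 : ℂ) * x 0 + (q 1 : ℂ) * x 1)) : False := by
  set κ : ℂ := (q 0 : ℂ) * x 0 + (q 1 : ℂ) * x 1 with hκdef
  by_cases hκ0 : κ = 0
  · rw [Fintype.linearIndependent_iff] at hx
    have hsum : ∑ i, ((q i : ℚ)) • x i = 0 := by
      rw [Fin.sum_univ_two]
      simp only [Rat.smul_def]
      push_cast
      rw [← hκ0, hκdef]
    have h := hx (fun i => (q i : ℚ)) hsum
    apply hq
    funext i
    exact_mod_cast h i
  · have hexp : cexp κ = cexp (x 0) ^ (q 0) * cexp (x 1) ^ (q 1) := by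
      rw [hκdef, Complex.exp_add, Complex.exp_int_mul, Complex.exp_int_mul]
    have halgκ : IsAlgebraic ℚ (cexp κ) := by
      rw [hexp]
      exact (isAlgebraic_zpow (halg 0) _).mul (isAlgebraic_zpow (halg 1) _)
    exact Literature.NumberTheory.Transcendental.transcendental_exp_holds hκ hκ0 halgκ

/-- LOG SECTOR, TRANSCENDENTAL PERIOD. If `e^{x₀}, e^{x₁}` are algebraic, `F ≠ 0` and `2πi` is
transcendental over `ℚ[x₀, x₁]`, then no NONZERO kernel translate `x + 2πik` lies on `V(F)`:
`t ↦ F(x + tk)` vanishes at `2πi`, hence identically, and `isAlgebraic_of_vanish_on_line` makes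
`k₁x₀ − k₀x₁` algebraic, against `not_isAlgebraic_intCombination`. [cite: Lindemann1882] -/
theorem logSector_transcendentalPeriod {x : Fin 2 → ℂ} (hx : LinearIndependent ℚ x)
    (halg : ∀ i, IsAlgebraic ℚ (cexp (x i))) {F : MvPolynomial (Fin 2) ℚ} (hF : F ≠ 0)
    (hT : Transcendental (Algebra.adjoin ℚ (Set.range x)) (2 * ↑Real.pi * I))
    {k : Fin 2 → ℤ} (hk : k ≠ 0)
    (hFk : MvPolynomial.aeval (fun i => x i + 2 * ↑Real.pi * I * (k i : ℂ)) F = 0) : False := by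
  set R : Subalgebra ℚ ℂ := Algebra.adjoin ℚ (Set.range x) with hR
  have hxR : ∀ j, x j ∈ R := fun j => Algebra.subset_adjoin (Set.mem_range_self j)
  -- the polynomial `t ↦ F(x + t k)` over `R = ℚ[x₀, x₁]`
  set g : Fin 2 → Polynomial R := fun j =>
    Polynomial.C (⟨x j, hxR j⟩ : R) + Polynomial.C ((k j : ℤ) : R) * Polynomial.X with hg
  set P : Polynomial R := MvPolynomial.aeval g F with hP
  have hPeval : ∀ t : ℂ, Polynomial.aeval t P =
      MvPolynomial.aeval (fun j => x j + t * (k j : ℂ)) F := by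
    intro t
    have e : (fun j => (Polynomial.aeval t).restrictScalars ℚ (g j)) =
        fun j => x j + t * (k j : ℂ) := by
      funext j
      simp only [AlgHom.restrictScalars_apply, hg, map_add, map_mul, Polynomial.aeval_C,
        Polynomial.aeval_X]
      have h1 : algebraMap R ℂ (⟨x j, hxR j⟩ : R) = x j := rfl
      have h2 : algebraMap R ℂ ((k j : ℤ) : R) = (k j : ℂ) := by
        rw [map_intCast]
      rw [h1, h2]
      ring
    rw [hP, ← AlgHom.restrictScalars_apply ℚ (Polynomial.aeval t),
      MvPolynomial.comp_aeval_apply, e]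
  -- it vanishes at the transcendental `2πi`, hence identically
  have hP0 : P = 0 := by
    by_contra hP0
    apply hT
    refine ⟨P, hP0, ?_⟩
    rw [hPeval]
    exact hFk
  have hvan : ∀ t : ℂ, MvPolynomial.aeval (fun j => x j + t * (k j : ℂ)) F = 0 := by
    intro t
    rw [← hPeval, hP0, map_zero]
  have hκ := isAlgebraic_of_vanish_on_line x k hk F hF hvan
  refine not_isAlgebraic_intCombination hx halg ![k 1, -k 0] ?_ ?_
  · intro h
    apply hk
    have h0 : k 1 = 0 := by simpa using congr_fun h 0
    have h1 : k 0 = 0 := by simpa using congr_fun h 1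
    funext i; fin_cases i <;> simp [h0, h1]
  · convert hκ using 1
    simp
    ring


end Literature.NumberTheory.Transcendental.KernelTranslatesRankTwo

end
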